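import Summits.QuantumFields.BalabanUV.Beta.GAN24.OneStepConstraintAxialDelKInputTriple
import Summits.QuantumFields.BalabanUV.Beta.GAN24.EffectiveFormVolumeLimitPeriodise
import Summits.QuantumFields.BalabanUV.Beta.GAN24.InsertionChainVolumeLimit

/-!
# `BalabanUV.Beta.GAN24.OneStepLoopCovarianceInputTriple` — binder row G-an2-4 ∕ (CONV-C), routes C-R6° («VALUES») × R7 («TWO CURRENCIES»), PART 195:
# THE LOOP COVARIANCE `Y_k = c_k⁻¹𝒢_kc_k⁻¹` OF CENSUS V196 IS AN INPUT TRIPLE, NO RESIDUAL HYPOTHESIS.  V196 (ζ) reads the one-loop contraction `tr(𝒢c⁻¹X_ic⁻¹𝒢c⁻¹X_jc⁻¹)` as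
# `Γ₁(Y ⊗ₖ Y)Γ₂ᴴ` with `Y = c⁻¹𝒢c⁻¹` and asks for `Y`'s INPUT triple ((UD), (SR), EL₂ in route R7's `distK` ∕ `unitIdx` currency).  The three factors are now tree theorems along the tower
# `n = L^k` on the unit torus `M_t = fine (Lb·1) (cubic (d+1) (s t)) = cubic (d+1) (Lb·s t)`: `𝒢_{L^k}` by PART 193, `c_k⁻¹ = Σ_k + a·1` by PART 132 (`decay_effForm`: (UD)+(SR) on every torus)
# and PART 194 (EL₂ along every cubic volume sequence, every dimension — road P2's periodisation).  PART 156 `mul_inputs` (the triple is closed under products) is applied twice.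
# Census V201‴ (ζ), first half (unit b2b-balaban-gan24-p3, gen 61; v1)

NOT IN PRINT; OUR PROOF ([folklore] bookkeeping BY NAME over PART 193 `exists_flucCov_DelK_axial_inputs`, PART 194 `exists_tendsto_inv_unitCovB_unitIdx`, PART 132 `DiagramDecayTorus.decay_effForm`,
PART 156 `InsertionChainVolumeLimit.mul_inputs` ∕ `inputs_of_le_rate`, PART 130 `DiagramDecayAlgebra` (`entryDecay_add`, `twoLevelDecayRate_mono`), PART 127 `UnitLatticeDecayAlgebra`
(`entryDecay_smul`, `entryDecay_one`, `distK_self`, `distK_nonneg`), `EffectiveFormDecay.entryDecay_of_le_rate`; [Balaban1987RG1] (1.20)–(1.22) p. 264 LOCATE the one-loop shape; nothing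
printed is a hypothesis).
HONEST FRAMING (cell contract, verbatim): «discharging `BetaPertH` makes Bałaban's UV stability UNCONDITIONAL — a real constructive-QFT result; it is NOT the
continuum limit and NOT the Clay problem.»  HONEST DEPENDENCY (verbatim): «continuum YM on T⁴ ⇐ BetaPertH ∧ nine spine estimates (0/9 proved); BetaPertH ⇐
(D1) ∧ (D4) ∧ CAP+tail; G-an2-4 gates asym, D1 and NE2/3/4.»

WHAT THIS FILE PROVES (0 sorry, 0 `def`; `M_t = fine (Lb·1) (cubic (d+1) (s t))`, `X_t k = (𝒢_{L^k,t} ⊗ ℂ) ∘ (unitIdx, unitIdx)` (PART 193), `c_{k,t} = unitCovB L M_t a ha k`, `Y_t k = c_{k,t}⁻¹·X_t k·c_{k,t}⁻¹`):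
* §1 `twoLevelDecayRate_of_le_ratio` ((SR) at ratio `θ` gives every ratio `θ′ ≥ θ`), `inv_unitCovB_inputs` (the INPUT triple of `c_k⁻¹` along every cubic volume sequence, `d + 1 ≥ 2`, `L ≥ 2`:
  (UD) `Bs + |a|`, (SR) PART 132's `(Bs′, κ′, √(L⁻¹))`, EL₂ by PART 194).
* §2 **`exists_loopCov_inputs`** — `∃ κ₀ > 0, B B′ ≥ 0`: (UD) `∀ t k, EntryDecay (distK L M_t) (Y_t k) B κ₀`; (SR) `∀ t, TwoLevelDecayRate (distK L M_t) Y_t B′ κ₀ (√(L⁻¹))`; EL₂ `∀ k μ ν z z′, ∃ s′,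
  Y_t k ((unitIdx)⁻¹(ẑ,μ)) ((unitIdx)⁻¹(ẑ′,ν)) → s′` — in dimension `d + 1 ≥ 2`, for all `L ≥ 2`, `Lb ≥ 1`, `a, a′ > 0`, every cubic coarse volume sequence `s t → ∞`; NO residual hypothesis.
WHAT IT IS NOT: the legs (the insertion words `X_i` and their decay, PART 159) and the contraction `Γ₁(Y ⊗ₖ Y)Γ₂ᴴ` itself (PARTs 150 ∕ 153's pattern) — census V201‴ (ζ) second half, follower;
first-order MODEL framing unchanged.  SUPPLIER work; NEVER «G-an2-4 closed»; NOT (CONV-C), NOT D1, NOT `BetaPertH`, NOT continuum, NOT Clay.  Records: `HOME/b2b-balaban-gan24-p3/gen61/README.md`.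
-/

noncomputable section

open scoped BigOperators ComplexConjugate Matrix
open Filter Topology Finset Matrix

namespace Summit.QuantumFields.BalabanUV.Beta.GAN24.OneStepLoopCovarianceInputTriple

open Literature.MathematicalPhysics.QuantumFieldTheory.Balaban1983to89
open Literature.MathematicalPhysics.QuantumFieldTheory.Balaban1983to89.B5Prop11Plancherel (Tor fine)
open Literature.MathematicalPhysics.QuantumFieldTheory.Balaban1983to89.B5RealFields (reM)
open Literature.MathematicalPhysics.QuantumFieldTheory.Balaban1983to89.B5G183RateUnitTower (lev)
open Literature.MathematicalPhysics.QuantumFieldTheory.Balaban1983to89.Beta.FreeLegDictionary (cubic)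
open Literature.MathematicalPhysics.QuantumFieldTheory.Balaban1983to89.Beta.VectorTails (castT)
open Literature.MathematicalPhysics.QuantumFieldTheory.Balaban1983to89.Beta.CompositionSingular (flucCov)
open Literature.MathematicalPhysics.QuantumFieldTheory.Balaban1983to89.Beta.BlockEffectiveAction (DelK)
open Summit.QuantumFields.BalabanUV.T4Continuum.BalabanLineAverage (QB)
open Summit.QuantumFields.BalabanUV.T4Continuum.BalabanAveragedTowerModes (par rem)
open Summit.QuantumFields.BalabanUV.T4Continuum.BalabanAveragedTowerUnit (idx unitCovB one_le_lev')
open Summit.QuantumFields.BalabanUV.T4Continuum.BalabanAveragedCoerciveTower (unitIdx)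
open Summit.QuantumFields.BalabanUV.T4Continuum.CTKingTowerWeights (distK)
open Summit.QuantumFields.BalabanUV.T4Continuum.DecayRateInterpolation (EntryDecay TwoLevelDecayRate)
open Summit.QuantumFields.BalabanUV.Beta.GAN24.DiagramDecayAlgebra (entryDecay_add twoLevelDecayRate_mono)
open Summit.QuantumFields.BalabanUV.Beta.GAN24.UnitLatticeDecayAlgebra (entryDecay_smul entryDecay_one distK_self distK_nonneg)
open Summit.QuantumFields.BalabanUV.Beta.GAN24.EffectiveFormDecay (entryDecay_of_le_rate)
open Summit.QuantumFields.BalabanUV.Beta.GAN24.DiagramDecayTorus (decay_effForm)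
open Summit.QuantumFields.BalabanUV.Beta.GAN24.InsertionChainVolumeLimit (mul_inputs inputs_of_le_rate)
open Summit.QuantumFields.BalabanUV.Beta.GAN24.OneStepConstraintBlockPresentation (tree_cpt_add_off)
open Summit.QuantumFields.BalabanUV.Beta.GAN24.OneStepConstraintAxialDelKInputTriple (exists_flucCov_DelK_axial_inputs)
open Summit.QuantumFields.BalabanUV.Beta.GAN24.EffectiveFormVolumeLimitPeriodise (exists_tendsto_inv_unitCovB_unitIdx)

variable {d : ℕ}

/-! ## §1 (SR) ratio monotonicity; the INPUT triple of `c_k⁻¹` -/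

/-- (SR) at ratio `θ` gives every ratio `θ′ ≥ θ` (`B, θ ≥ 0`). [folklore] -/
theorem twoLevelDecayRate_of_le_ratio {n : Type*} [Fintype n] [DecidableEq n] {dist : n → n → ℝ} {c : ℕ → Matrix n n ℂ} {B δ θ θ' : ℝ}
    (hc : TwoLevelDecayRate dist c B δ θ) (hB : 0 ≤ B) (hθ : 0 ≤ θ) (hθθ' : θ ≤ θ') : TwoLevelDecayRate dist c B δ θ' := fun k x y =>
  (hc k x y).trans (mul_le_mul_of_nonneg_right (mul_le_mul_of_nonneg_left (pow_le_pow_left₀ hθ hθθ' k) hB) (Real.exp_pos _).le)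

variable (L : ℕ) [NeZero L] (a : ℝ) (ha : 0 < a)

/-- **`inv_unitCovB_inputs` — THE INPUT TRIPLE OF `c_k⁻¹ = Σ_k + a·1`** (`L ≥ 2`, dimension `d + 1 ≥ 2`, every cubic volume sequence `s t → ∞`): (UD) with constant `Bs + |a|` and (SR) with PART 132's
`(Bs′, κ′, √(L⁻¹))` on EVERY torus (PART 132 `decay_effForm` + the identity's decay), EL₂ by PART 194 — NO residual hypothesis. [folklore] -/
theorem inv_unitCovB_inputs (hL : 2 ≤ L) (hd : 1 ≤ d) (s : ℕ → ℕ) [∀ t, NeZero (s t)] (hs : Tendsto s atTop atTop) :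
    ∃ κ' Bs Bs' : ℝ, 0 < κ' ∧ 0 ≤ Bs ∧ 0 ≤ Bs' ∧
      (∀ t k, EntryDecay (distK L (cubic (d + 1) (s t))) ((unitCovB L (cubic (d + 1) (s t)) a ha k)⁻¹) (Bs + ‖(a : ℂ)‖ * 1) κ') ∧
      (∀ t, TwoLevelDecayRate (distK L (cubic (d + 1) (s t))) (fun k => (unitCovB L (cubic (d + 1) (s t)) a ha k)⁻¹) Bs' κ' (Real.sqrt ((L : ℝ)⁻¹))) ∧
      (∀ (k : ℕ) (μ ν : Fin (d + 1)) (z z' : Fin (d + 1) → ℤ), ∃ s' : ℂ,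
        Tendsto (fun t => (unitCovB L (cubic (d + 1) (s t)) a ha k)⁻¹ ((unitIdx L (cubic (d + 1) (s t))).symm (castT (cubic (d + 1) (s t)) z, μ))
          ((unitIdx L (cubic (d + 1) (s t))).symm (castT (cubic (d + 1) (s t)) z', ν))) atTop (𝓝 s')) := by
  have hd' : 2 ≤ d + 1 := by omega
  obtain ⟨κ', Bs, Bs', hκ', hBs, hBs', h⟩ := decay_effForm L a ha hL hd'
  refine ⟨κ', Bs, Bs', hκ', hBs, hBs', fun t k => ?_, fun t => ?_, fun k μ ν z z' => exists_tendsto_inv_unitCovB_unitIdx L a ha s hs k μ ν z z'⟩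
  · have e : (unitCovB L (cubic (d + 1) (s t)) a ha k)⁻¹ = ((unitCovB L (cubic (d + 1) (s t)) a ha k)⁻¹ - (a : ℂ) • (1 : Matrix (idx L (cubic (d + 1) (s t)) 0) (idx L (cubic (d + 1) (s t)) 0) ℂ))
        + (a : ℂ) • (1 : Matrix (idx L (cubic (d + 1) (s t)) 0) (idx L (cubic (d + 1) (s t)) 0) ℂ) := (sub_add_cancel _ _).symm
    rw [e]
    exact entryDecay_add ((h (cubic (d + 1) (s t))).1 k) (entryDecay_smul (entryDecay_one (distK_self L (cubic (d + 1) (s t))) κ') (a : ℂ))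
  · intro k x y
    have h2 := (h (cubic (d + 1) (s t))).2 k x y
    rwa [sub_sub_sub_cancel_right] at h2

/-! ## §2 The loop covariance `Y_k = c_k⁻¹𝒢_kc_k⁻¹` as an INPUT triple -/

section Loop

variable (Lb : ℕ) [NeZero Lb] (s : ℕ → ℕ) [hs0 : ∀ t, NeZero (s t)]

/-- **`exists_loopCov_inputs` — THE LOOP COVARIANCE OF CENSUS V196 IS AN INPUT TRIPLE, NO RESIDUAL HYPOTHESIS**: in dimension `d + 1 ≥ 2`, for all `L ≥ 2`, `Lb ≥ 1`, `a, a′ > 0` and every cubic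
coarse volume sequence `s t → ∞`, the tower `Y_t k = c_{k,t}⁻¹·X_t k·c_{k,t}⁻¹` (`X_t k` = PART 193's presented gauge-fixed one-loop letter `𝒢_{L^k,t}`, `c_{k,t} = unitCovB L M_t a ha k`,
`M_t = fine (Lb·1) (cubic (d+1) (s t))`) has (UD) `EntryDecay (distK L M_t) (Y_t k) B κ₀`, (SR) `TwoLevelDecayRate (distK L M_t) Y_t B′ κ₀ (√(L⁻¹))` and EL₂ at every pair of `unitIdx` readings — PART 156
`mul_inputs` twice on §1 and PART 193 (rates equalised to the minimum, ratios to `√(L⁻¹)`). [folklore] -/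
theorem exists_loopCov_inputs (hL : 2 ≤ L) (hd : 1 ≤ d) (hs : Tendsto s atTop atTop) {a' : ℝ} (ha' : 0 < a') :
    ∃ κ₀ B B' : ℝ, 0 < κ₀ ∧ 0 ≤ B ∧
      (∀ t k, EntryDecay (distK L (fine (Lb * 1) (cubic (d + 1) (s t)))) ((unitCovB L (fine (Lb * 1) (cubic (d + 1) (s t))) a ha k)⁻¹ * (((flucCov (reM (DelK (lev L k) (one_le_lev' L k) (fine (Lb * 1) (cubic (d + 1) (s t))) a ha)) (Matrix.fromRows (reM (QB 1 Lb (cubic (d + 1) (s t)))) (fun (t' : {x : Tor (fine (Lb * 1) (cubic (d + 1) (s t))) × Fin (d + 1) // (∀ ν, ν < x.2 → ((rem 1 Lb (cubic (d + 1) (s t)) x.1 ν : ℕ)) = 0) ∧ ((rem 1 Lb (cubic (d + 1) (s t)) x.1 x.2 : ℕ)) + 1 < Lb}) (x : Tor (fine (Lb * 1) (cubic (d + 1) (s t))) × Fin (d + 1)) => if x = (Function.Embedding.subtype (fun x : Tor (fine (Lb * 1) (cubic (d + 1) (s t))) × Fin (d + 1) => (∀ ν, ν < x.2 → ((rem 1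 Lb (cubic (d + 1) (s t)) x.1 ν : ℕ)) = 0) ∧ ((rem 1 Lb (cubic (d + 1) (s t)) x.1 x.2 : ℕ)) + 1 < Lb)) t' then (1 : ℝ) else 0))).map ((↑) : ℝ → ℂ)).submatrix (unitIdx L (fine (Lb * 1) (cubic (d + 1) (s t)))) (unitIdx L (fine (Lb * 1) (cubic (d + 1) (s t))))) * (unitCovB L (fine (Lb * 1) (cubic (d + 1) (s t))) a ha k)⁻¹) B κ₀) ∧
      (∀ t, TwoLevelDecayRate (distK L (fine (Lb * 1) (cubic (d + 1) (s t)))) (fun k => (unitCovB L (fine (Lb * 1) (cubic (d + 1) (s t))) a ha k)⁻¹ * (((flucCov (reM (DelK (lev L k) (one_le_lev' L k) (fine (Lb * 1) (cubic (d + 1) (s t))) a ha)) (Matrix.fromRows (reM (QB 1 Lb (cubic (d + 1) (s t)))) (fun (t' : {x : Tor (fine (Lb * 1) (cubic (d + 1) (s t))) × Fin (d + 1) // (∀ ν, ν < x.2 → ((rem 1 Lb (cubic (d + 1) (s t)) x.1 ν : ℕ)) = 0) ∧ ((rem 1 Lb (cubic (d + 1) (s t)) x.1 x.2 : ℕ))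 + 1 < Lb}) (x : Tor (fine (Lb * 1) (cubic (d + 1) (s t))) × Fin (d + 1)) => if x = (Function.Embedding.subtype (fun x : Tor (fine (Lb * 1) (cubic (d + 1) (s t))) × Fin (d + 1) => (∀ ν, ν < x.2 → ((rem 1 Lb (cubic (d + 1) (s t)) x.1 ν : ℕ)) = 0) ∧ ((rem 1 Lb (cubic (d + 1) (s t)) x.1 x.2 : ℕ)) + 1 < Lb)) t' then (1 : ℝ) else 0))).map ((↑) : ℝ → ℂ)).submatrix (unitIdx L (fine (Lb * 1) (cubic (d + 1) (s t)))) (unitIdx L (fine (Lb * 1) (cubic (d + 1) (s t))))) * (unitCovB L (fine (Lb * 1) (cubic (d + 1) (s t))) a ha k)⁻¹) B' κ₀ (Real.sqrt ((L : ℝ)⁻¹))) ∧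
      (∀ (k : ℕ) (μ ν : Fin (d + 1)) (z z' : Fin (d + 1) → ℤ), ∃ s' : ℂ, Tendsto (fun t => ((unitCovB L (fine (Lb * 1) (cubic (d + 1) (s t))) a ha k)⁻¹ * (((flucCov (reM (DelK (lev L k) (one_le_lev' L k) (fine (Lb * 1) (cubic (d + 1) (s t))) a ha)) (Matrix.fromRows (reM (QB 1 Lb (cubic (d + 1) (s t)))) (fun (t' : {x : Tor (fine (Lb * 1) (cubic (d + 1) (s t))) × Fin (d + 1) // (∀ ν, ν < x.2 → ((rem 1 Lb (cubic (d + 1) (s t)) x.1 ν : ℕ)) = 0) ∧ ((rem 1 Lb (cubic (d + 1) (s t)) x.1 x.2 : ℕ)) + 1 < Lb}) (x : Tor (fine (Lb * 1) (cubic (d + 1) (s t))) × Fin (d + 1)) => if x = (Function.Embedding.subtype (fun x : Tor (fine (Lb * 1) (cubic (d + 1) (s t))) × Fin (d + 1) => (∀ ν, ν < x.2 → ((rem 1 Lb (cubic (d + 1) (s t)) x.1 ν : ℕ)) = 0) ∧ ((rem 1 Lb (cubic (d + 1) (s t)) x.1 x.2 : ℕ)) + 1 < Lb)) t' then (1 :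 ℝ) else 0))).map ((↑) : ℝ → ℂ)).submatrix (unitIdx L (fine (Lb * 1) (cubic (d + 1) (s t)))) (unitIdx L (fine (Lb * 1) (cubic (d + 1) (s t))))) * (unitCovB L (fine (Lb * 1) (cubic (d + 1) (s t))) a ha k)⁻¹) ((unitIdx L (fine (Lb * 1) (cubic (d + 1) (s t)))).symm (castT (fine (Lb * 1) (cubic (d + 1) (s t))) z, μ)) ((unitIdx L (fine (Lb * 1) (cubic (d + 1) (s t)))).symm (castT (fine (Lb * 1) (cubic (d + 1) (s t))) z', ν))) atTop (𝓝 s')) := by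
  have hd' : 2 ≤ d + 1 := by omega
  have hL1 : (1 : ℝ) ≤ L := by exact_mod_cast le_trans (by norm_num) hL
  have hside : Tendsto (fun t => Lb * 1 * s t) atTop atTop :=
    Filter.tendsto_atTop_mono (fun t => Nat.le_mul_of_pos_left _ (Nat.pos_of_ne_zero (NeZero.ne (Lb * 1)))) hs
  -- the two factors' triples
  obtain ⟨κ', Bs, Bs', hκ', hBs, hBs', hCud, hCsr, hCel⟩ := inv_unitCovB_inputs L a ha hL hd (fun t => Lb * 1 * s t) hside
  obtain ⟨κ, B, hκ, hB, hGud, hGsr, hGel⟩ := exists_flucCov_DelK_axial_inputs L Lb a ha s hd hs ha'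
  -- common rate `κ₀ = min κ′ κ` and common ratio `√(L⁻¹)` (`(L²)⁻¹ ≤ √(L⁻¹)`)
  have hκ₀ : 0 < min κ' κ := lt_min hκ' hκ
  have hθ0 : 0 ≤ ((L : ℝ) ^ 2)⁻¹ := by positivity
  have hθle : ((L : ℝ) ^ 2)⁻¹ ≤ Real.sqrt ((L : ℝ)⁻¹) := by
    have h1 : ((L : ℝ) ^ 2)⁻¹ ≤ (L : ℝ)⁻¹ := by
      rw [inv_le_inv₀ (by positivity) (by positivity)]; nlinarith
    have h2 : (L : ℝ)⁻¹ ≤ Real.sqrt ((L : ℝ)⁻¹) := by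
      have h3 : (L : ℝ)⁻¹ ≤ 1 := inv_le_one_of_one_le₀ hL1
      have h4 : 0 ≤ (L : ℝ)⁻¹ := by positivity
      calc (L : ℝ)⁻¹ = Real.sqrt ((L : ℝ)⁻¹) * Real.sqrt ((L : ℝ)⁻¹) := (Real.mul_self_sqrt h4).symm
        _ ≤ Real.sqrt ((L : ℝ)⁻¹) * 1 := mul_le_mul_of_nonneg_left ((Real.sqrt_le_one).mpr h3) (Real.sqrt_nonneg _)
        _ = Real.sqrt ((L : ℝ)⁻¹) := mul_one _
    exact h1.trans h2
  have hBa : 0 ≤ Bs + ‖(a : ℂ)‖ * 1 := by positivity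
  obtain ⟨hCud', hCsr'⟩ := inputs_of_le_rate L (side := fun t => Lb * 1 * s t) hBa hBs' (Real.sqrt_nonneg _) (min_le_left κ' κ) hCud hCsr
  obtain ⟨hGud', hGsr'⟩ := inputs_of_le_rate L (side := fun t => Lb * 1 * s t) hB hB hθ0 (min_le_right κ' κ) hGud hGsr
  have hGsr'' := fun t => twoLevelDecayRate_of_le_ratio (hGsr' t) hB hθ0 hθle
  -- first product `c⁻¹·X`
  obtain ⟨S₁, hS₁, hud₁, hsr₁, hel₁⟩ := mul_inputs L hd' hside hκ₀ hBa hCud' hCsr' hGud' hGsr'' hCel hGel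
  -- second product `(c⁻¹·X)·c⁻¹`
  have hκ₁ : 0 < min κ' κ / 2 := half_pos hκ₀
  have hB₁ : 0 ≤ (Bs + ‖(a : ℂ)‖ * 1) * B * ((((d + 1 : ℕ)) : ℝ) * S₁) := by positivity
  obtain ⟨hCud₂, hCsr₂⟩ := inputs_of_le_rate L (side := fun t => Lb * 1 * s t) hBa hBs' (Real.sqrt_nonneg _) (half_le_self hκ₀.le) hCud' hCsr'
  obtain ⟨S₂, hS₂, hud₂, hsr₂, hel₂⟩ := mul_inputs L hd' hside hκ₁ hB₁ hud₁ hsr₁ hCud₂ hCsr₂ hel₁ hCel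
  exact ⟨min κ' κ / 2 / 2, _, _, half_pos hκ₁, by positivity, hud₂, hsr₂, hel₂⟩

end Loop

end Summit.QuantumFields.BalabanUV.Beta.GAN24.OneStepLoopCovarianceInputTriple

end
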